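import Summits.ResolutionOfSingularities.ResolutionOfSingularities.Theorems.RadicialJungCleanModelsCleanPermissibleLeadWitness
import Summits.ResolutionOfSingularities.ResolutionOfSingularities.Theorems.MarkedTransferCampaignW46MohWindowSurfaceResidualOrder
import HarnessLib

/-!
# Route `RadicialJung`, crux `CleanModels` (stmt-ResolutionOfSingularities-15917), line `Sketch` rev 35, stub 6 `stub_cleanProp44` (X44c):
# THE WITNESS ONE POINT BLOW-UP LATER — the strict transform is STILL not clean-permissible, the near line IS

Seat `leafhand-res-radicialjung-1` g0 (land-only hand).  Companion of `RadicialJungCleanModelsCleanPermissibleDerivationObstruction.lean`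
(first- and second-order derivation obstructions to `CleanPermissibleAt`) and `RadicialJungCleanModelsCleanPermissibleLeadWitness.lean`.

Blow up the closed point of the lead's witness (`G = t₁`, `Y = V(t₂, t₁ - t₃²)`) and pass to the point of the strict transform `Y'`: in the
`t₃`-chart with `x := t₁/t₃ - t₃`, `y := t₂/t₃`, `z := t₃` one finds `Y' = V(x, y)` (the `z`-axis), the transform of the line is that of
`G = t₁ = z (x + z)`, and — in the crossing configuration of memo `Sketch-memo-hand2-g12-stubs-5-7.md` §3, `J' = (x, yz)^μ` — the NEAR LINE born in
the exceptional divisor `V(z)` is `L = V(x, z)`.  This file records, as kernel theorems over an ABSTRACT regular local ring `R` of dimension `3`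
with regular system of parameters `(x, y, z)` (so that no polynomial-ring or blow-up plumbing is needed):

* `cleanRegAt_blowupWitness` — the line of `G = z (x + z)` is clean-regular at `R` (form (1): `z · (x+z)`, exponents `1, 1`);
* `cleanPermissibleAt_nearLine_blowupWitness` — **the near line `L = V(x, z)` IS clean-permissible** for it (adapted system `(z, x + z; y)`);
* `not_cleanPermissibleAt_strictTransform_blowupWitness` — **the strict transform `Y' = V(x, y)` is STILL NOT clean-permissible** (`p` odd,
  residue field `p`-perfect), given a derivation `∂_y` (`∂_y x = ∂_y z = 0`, `∂_y y = 1`) and a derivation `δ` VANISHING AT THE POINT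
  (`δ (R) ⊆ 𝔪`) with `δ x = x + 2z`, `δ y = 0`, `δ z = -z` — in coordinates `δ = (x + 2z) ∂_x - z ∂_z`, the tangent derivation killing `z (x + z)` —,
  both extending along `f : R → F` to derivations of `F`.  The FIRST-order obstruction (`x ∣ d x`) no longer suffices here (the exceptional
  coordinate `z` divides `∂_y z = 0` and `δ z = -z`); the proof uses the SECOND-order one (`IsRsopPart.sum_logDerivative_mem_maximalIdeal`:
  `δ w ∈ w 𝔪` for the transversal member `w`, impossible since `δ w ≡ A x + (2A - Γ) z (mod 𝔪²)` with `Γ` a unit).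

So at a crossing of two such curves the clean-permissible move after the point blow-up is the near line, not the strict transforms (which need
one more insertion: after blowing up `L`, `G = z² (x₁ + 1)` and `Y'' = V(x₁, y)` is clean-permissible with `w = z`, exponent `2`).  All
hypotheses hold in `k[x, y, z]_{(x,y,z)} ⊆ k(x, y, z)`, `k` perfect of odd characteristic.

Honest framing: OURS, elementary; local evidence for the design of (R1)/(R3) of X44c (memo hand2-g16 §4).  Nothing here proves X44c, any case of
`CleanModels`, or resolution of singularities in characteristic `p`.
Setting only: [cite: CossartPiltant2008, Prop. 4.4, Lemma 4.3 (5)] [cite: Piltant2013, §2 Axiom 4] [cite: Matsumura1987, Thm. 14.2, Thm. 14.3].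
-/

noncomputable section

set_option linter.dupNamespace false -- mandated namespace of this single-conjunct summit

open IsLocalRing
open Literature.AlgebraicGeometry.Resolution
open Summit.ResolutionOfSingularities.ResolutionOfSingularities.Theorems.CampaignW46.MohWindowSurfaceResidualOrder (range_vec3)

namespace Summit.ResolutionOfSingularities.ResolutionOfSingularities.Theorems.RadicialJung.CleanModels

universe u v

section BlowupWitness

variable {R : Type u} [CommRing R] [IsLocalRing R]

/-- `(x, y, z)` as an `IsRsopPart` family. [folklore] -/
theorem isRsopPart_vec3_of_span_eq (hR : IsRegularLocalRing R) (hdim : ringKrullDim R = 3) {x y z : R}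
    (h : Ideal.span ({x, y, z} : Set R) = maximalIdeal R) : IsRsopPart ![x, y, z] := by
  refine ⟨hR, 0, Fin.elim0, by rw [hdim]; norm_cast, ?_⟩
  have h0 : Set.range (Fin.elim0 : Fin 0 → R) = ∅ := Set.range_eq_empty _
  rw [h0, Set.union_empty, range_vec3, h]

/-- The coordinates `(z, x + z, y)` generate `𝔪` when `(x, y, z)` do. [folklore] -/
theorem span_nearLine_coords_eq {x y z : R} (h : Ideal.span ({x, y, z} : Set R) = maximalIdeal R) :
    Ideal.span ({z, x + z, y} : Set R) = maximalIdeal R := by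
  rw [← h]
  apply le_antisymm
  · rw [Ideal.span_le, Set.insert_subset_iff, Set.insert_subset_iff, Set.singleton_subset_iff]
    exact ⟨Ideal.subset_span (by simp), Ideal.add_mem _ (Ideal.subset_span (by simp)) (Ideal.subset_span (by simp)),
      Ideal.subset_span (by simp)⟩
  · rw [Ideal.span_le, Set.insert_subset_iff, Set.insert_subset_iff, Set.singleton_subset_iff]
    refine ⟨?_, Ideal.subset_span (by simp), Ideal.subset_span (by simp)⟩
    have hx : (x + z) - z ∈ Ideal.span ({z, x + z, y} : Set R) :=
      Ideal.sub_mem _ (Ideal.subset_span (by simp)) (Ideal.subset_span (by simp))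
    rw [SetLike.mem_coe]
    convert hx using 1
    ring

/-- **The stage is clean**: the line of `G = z (x + z)` is clean-regular at `R` (loose clean form (1) in the regular system of parameters
`(z, x + z, y)`, exponents `1, 1`). [cite: Piltant2013, Def. 2.1] -/
theorem cleanRegAt_blowupWitness {F : Type v} [Field F] {p : ℕ} [hp : Fact p.Prime] (f : R →+* F) (hR : IsRegularLocalRing R)
    (hdim : ringKrullDim R = 3) {x y z : R} (h : Ideal.span ({x, y, z} : Set R) = maximalIdeal R) :
    CleanRegAt p f (f (z * (x + z))) := by
  classical
  have h1p : 1 < p := hp.out.one_lt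
  refine ⟨hR, Pi.single (⟨1, h1p⟩ : Fin p) (1 : F), ⟨⟨1, h1p⟩, one_ne_zero, by simp⟩, ?_⟩
  have hsum : (∑ j : Fin p, (Pi.single (⟨1, h1p⟩ : Fin p) (1 : F) : Fin p → F) j ^ p * f (z * (x + z)) ^ (j : ℕ)) =
      f (z * (x + z)) := by
    rw [Finset.sum_eq_single (⟨1, h1p⟩ : Fin p)]
    · simp
    · intro j _ hj
      rw [Pi.single_eq_of_ne hj, zero_pow hp.out.ne_zero, zero_mul]
    · intro h; exact absurd (Finset.mem_univ _) h
  rw [hsum]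
  refine Or.inl ⟨3, 2, by norm_num, ![z, x + z, y], ![1, 1], 1, isUnit_one, ?_, by rw [hdim]; norm_cast, Nat.succ_pos 1, ?_, ?_⟩
  · rw [range_vec3, span_nearLine_coords_eq h]
  · intro i
    fin_cases i <;> simpa using hp.out.one_lt.ne'
  · simp [Fin.prod_univ_two]

/-- **The near line is clean-permissible**: `L = V(x, z)` is clean-permissible at `R` for the line of `G = z (x + z)` — adapted system
`c = (z, x + z)` (generating `(x, z)`), `w = y`, representative `G = c₁ c₂` with exponents `1, 1`. [cite: Piltant2013, §2 Axiom 4] -/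
theorem cleanPermissibleAt_nearLine_blowupWitness {F : Type v} [Field F] {p : ℕ} [hp : Fact p.Prime] (f : R →+* F)
    (hR : IsRegularLocalRing R) (hdim : ringKrullDim R = 3) {x y z : R} (h : Ideal.span ({x, y, z} : Set R) = maximalIdeal R) :
    CleanPermissibleAt p f (f (z * (x + z))) (Ideal.span ({x, z} : Set R)) := by
  classical
  have h1p : 1 < p := hp.out.one_lt
  refine ⟨hR, 2, 1, ![z, x + z], ![y], ?_, by rw [hdim]; norm_cast, ?_, Pi.single (⟨1, h1p⟩ : Fin p) (1 : F),
    ⟨⟨1, h1p⟩, one_ne_zero, by simp⟩, Or.inl ⟨![1, 1], ![0], 1, isUnit_one, Or.inl ⟨0, by simpa using hp.out.one_lt.ne'⟩, ?_⟩⟩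
  · -- `(z, x + z, y)` generates `𝔪`
    have happ : Fin.append ![z, x + z] ![y] = ![z, x + z, y] := by
      ext i; fin_cases i <;> rfl
    have hr : Set.range (Fin.append ![z, x + z] ![y]) = {z, x + z, y} := by rw [happ, range_vec3]
    rw [hr, span_nearLine_coords_eq h]
  · -- `(z, x + z) = (x, z)`
    have hr : Set.range ![z, x + z] = {z, x + z} := by
      ext a
      simp only [Set.mem_range, Set.mem_insert_iff, Set.mem_singleton_iff]
      constructor
      · rintro ⟨i, rfl⟩
        fin_cases i <;> simp
      · rintro (rfl | rfl)
        exacts [⟨0, rfl⟩, ⟨1, rfl⟩]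
    rw [hr]
    apply le_antisymm
    · rw [Ideal.span_le, Set.insert_subset_iff, Set.singleton_subset_iff]
      exact ⟨Ideal.subset_span (by simp), Ideal.add_mem _ (Ideal.subset_span (by simp)) (Ideal.subset_span (by simp))⟩
    · rw [Ideal.span_le, Set.insert_subset_iff, Set.singleton_subset_iff]
      refine ⟨?_, Ideal.subset_span (by simp)⟩
      have hx : (x + z) - z ∈ Ideal.span ({z, x + z} : Set R) :=
        Ideal.sub_mem _ (Ideal.subset_span (by simp)) (Ideal.subset_span (by simp))
      rw [SetLike.mem_coe]
      convert hx using 1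
      ring
  · -- the representative
    have hsum : (∑ j : Fin p, (Pi.single (⟨1, h1p⟩ : Fin p) (1 : F) : Fin p → F) j ^ p * f (z * (x + z)) ^ (j : ℕ)) =
        f (z * (x + z)) := by
      rw [Finset.sum_eq_single (⟨1, h1p⟩ : Fin p)]
      · simp
      · intro j _ hj
        rw [Pi.single_eq_of_ne hj, zero_pow hp.out.ne_zero, zero_mul]
      · intro h; exact absurd (Finset.mem_univ _) h
    rw [hsum]
    simp [Fin.prod_univ_two]

/-- Strict transform, step (i): a minimal generator `c` of `I = (x, y)` dividing `∂_y c` does not divide `δ c`.  Writing `c = α x + β y`: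
`∂_y c ≡ β (mod 𝔪)`, so `c ∣ ∂_y c` forces `β ∈ 𝔪`, hence `α` is a unit (`c ∉ 𝔪²`); then `δ c ≡ 2 α z (mod I)` and `c ∣ δ c` would put `z` in
the prime `I`. [cite: Matsumura1987, Thm. 14.2] -/
theorem strictTransform_gen (hR : IsRegularLocalRing R) (hdim : ringKrullDim R = 3) {p : ℕ} [Fact p.Prime] [CharP R p] (hp2 : p ≠ 2)
    {x y z : R} (h : Ideal.span ({x, y, z} : Set R) = maximalIdeal R) (dy δ : Derivation ℤ R R)
    (hyx : dy x = 0) (hyy : dy y = 1) (hδx : δ x = x + 2 * z) (hδy : δ y = 0) {c : R}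
    (hcI : c ∈ Ideal.span ({x, y} : Set R)) (hc2 : c ∉ maximalIdeal R ^ 2) (hdvd : c ∣ dy c) : ¬ c ∣ δ c := by
  have hz := isRsopPart_vec3_of_span_eq hR hdim h
  set I : Ideal R := Ideal.span ({x, y} : Set R) with hI
  -- `I` is prime, `z ∉ I`
  have hcomp : Set.range ((![x, y, z] : Fin 3 → R) ∘ Fin.castLE (by norm_num : 2 ≤ 3)) = {x, y} := by
    ext a
    simp only [Set.mem_range, Function.comp_apply, Set.mem_insert_iff, Set.mem_singleton_iff]
    constructor
    · rintro ⟨i, rfl⟩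
      fin_cases i
      · exact Or.inl rfl
      · exact Or.inr rfl
    · rintro (rfl | rfl)
      · exact ⟨0, rfl⟩
      · exact ⟨1, rfl⟩
  have hIprime : I.IsPrime := by
    have hpr := (hz.comp (Fin.castLE (by norm_num : 2 ≤ 3)) (Fin.castLE_injective _)).isPrime_span_range
    rwa [hcomp] at hpr
  have hzI : z ∉ I := by
    have hne := hz.not_mem_span_image (S := ({0, 1} : Set (Fin 3))) (i := 2) (by decide)
    rwa [Set.image_insert_eq, Set.image_singleton] at hne
  have hIm : I ≤ maximalIdeal R := IsLocalRing.le_maximalIdeal hIprime.ne_top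
  have hxm : x ∈ maximalIdeal R := h ▸ Ideal.subset_span (by simp)
  have hym : y ∈ maximalIdeal R := h ▸ Ideal.subset_span (by simp)
  have hzm : z ∈ maximalIdeal R := h ▸ Ideal.subset_span (by simp)
  have hcm : c ∈ maximalIdeal R := hIm hcI
  obtain ⟨α, β, hc⟩ := Ideal.mem_span_pair.mp hcI
  -- `∂_y c ≡ β (mod 𝔪)`; `c ∣ ∂_y c` with `c ∈ 𝔪` forces `β ∈ 𝔪`
  have hdyc : dy c = β + (x * dy α + y * dy β) := by
    rw [← hc, map_add, Derivation.leibniz, Derivation.leibniz, hyx, hyy]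
    simp only [smul_eq_mul]
    ring
  have hβ : β ∈ maximalIdeal R := by
    obtain ⟨r, hr⟩ := hdvd
    have h1 : β = c * r - (x * dy α + y * dy β) := by rw [← hr, hdyc]; ring
    rw [h1]
    exact Ideal.sub_mem _ (Ideal.mul_mem_right _ _ hcm)
      (Ideal.add_mem _ (Ideal.mul_mem_right _ _ hxm) (Ideal.mul_mem_right _ _ hym))
  -- hence `α` is a unit
  have hα : IsUnit α := by
    by_contra hα
    have hαm : α ∈ maximalIdeal R := (IsLocalRing.mem_maximalIdeal α).mpr hα
    apply hc2
    rw [← hc, pow_two]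
    exact Ideal.add_mem _ (Ideal.mul_mem_mul hαm hxm) (Ideal.mul_mem_mul hβ hym)
  -- `δ c ≡ 2 α z (mod I)`
  have hδc : δ c = 2 * α * z + (x * (α + δ α) + y * δ β) := by
    rw [← hc, map_add, Derivation.leibniz, Derivation.leibniz, hδx, hδy]
    simp only [smul_eq_mul]
    ring
  intro hdvdδ
  have hδcI : δ c ∈ I := by
    obtain ⟨r, hr⟩ := hdvdδ
    rw [hr]; exact Ideal.mul_mem_right _ _ hcI
  have hxI : x ∈ I := Ideal.subset_span (by simp)
  have hyI : y ∈ I := Ideal.subset_span (by simp)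
  have h2αz : 2 * α * z ∈ I := by
    have h1 : 2 * α * z = δ c - (x * (α + δ α) + y * δ β) := by rw [hδc]; ring
    rw [h1]
    exact Ideal.sub_mem _ hδcI (Ideal.add_mem _ (Ideal.mul_mem_right _ _ hxI) (Ideal.mul_mem_right _ _ hyI))
  have h2 : IsUnit (2 : R) := by
    have h2' := isUnit_natCast_of_not_dvd p (S := R)
      (fun hd => hp2 ((Nat.prime_dvd_prime_iff_eq Fact.out Nat.prime_two).mp hd))
    simpa using h2'
  have h2α : IsUnit (2 * α) := h2.mul hα
  exact hzI ((Ideal.unit_mul_mem_iff_mem I h2α).mp (by simpa [mul_assoc] using h2αz))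

/-- Strict transform, step (ii): for a parameter `w` transversal to `I = (x, y)` (`w ∈ 𝔪 ∖ (I + 𝔪²)`), `δ w ∉ w 𝔪`.  Writing `w = A x + B y + Γ z`,
transversality makes `Γ` a unit, and `δ w ≡ A x + (2A - Γ) z (mod 𝔪²)` (`δ (R) ⊆ 𝔪`); `δ w ∈ w 𝔪 ⊆ 𝔪²` would force `A, 2A - Γ ∈ 𝔪` by the linear
independence of `(x, y, z)` modulo `𝔪²`. [cite: Matsumura1987, Thm. 14.2] -/
theorem strictTransform_trans (hR : IsRegularLocalRing R) (hdim : ringKrullDim R = 3) {x y z : R}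
    (h : Ideal.span ({x, y, z} : Set R) = maximalIdeal R) (δ : Derivation ℤ R R) (hδm : ∀ r : R, δ r ∈ maximalIdeal R)
    (hδx : δ x = x + 2 * z) (hδy : δ y = 0) (hδz : δ z = -z) {w : R} (hwm : w ∈ maximalIdeal R)
    (hw2 : w ∉ Ideal.span ({x, y} : Set R) ⊔ maximalIdeal R ^ 2) {r : R} (hr : r ∈ maximalIdeal R) (hδw : δ w = w * r) : False := by
  have hz := isRsopPart_vec3_of_span_eq hR hdim h
  set I : Ideal R := Ideal.span ({x, y} : Set R) with hI
  have hxm : x ∈ maximalIdeal R := h ▸ Ideal.subset_span (by simp)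
  have hym : y ∈ maximalIdeal R := h ▸ Ideal.subset_span (by simp)
  have hzm : z ∈ maximalIdeal R := h ▸ Ideal.subset_span (by simp)
  obtain ⟨A, B, Γ, hw⟩ := exists_eq_combination_of_mem_span_triple (h ▸ hwm : w ∈ Ideal.span ({x, y, z} : Set R))
  -- `Γ` is a unit
  have hΓ : IsUnit Γ := by
    by_contra hΓ
    have hΓm : Γ ∈ maximalIdeal R := (IsLocalRing.mem_maximalIdeal Γ).mpr hΓ
    apply hw2
    rw [hw]
    refine Ideal.add_mem _ (Ideal.add_mem _ (Ideal.mem_sup_left (Ideal.mul_mem_left _ _ (Ideal.subset_span (by simp))))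
      (Ideal.mem_sup_left (Ideal.mul_mem_left _ _ (Ideal.subset_span (by simp))))) (Ideal.mem_sup_right ?_)
    rw [pow_two]
    exact Ideal.mul_mem_mul hΓm hzm
  -- `δ w = A x + (2A - Γ) z + (second order)`
  have hδw' : δ w = A * x + (2 * A - Γ) * z + (x * δ A + y * δ B + z * δ Γ) := by
    rw [hw, map_add, map_add, Derivation.leibniz, Derivation.leibniz, Derivation.leibniz, hδx, hδy, hδz]
    simp only [smul_eq_mul]
    ring
  have hsq : A * x + (2 * A - Γ) * z ∈ maximalIdeal R ^ 2 := by
    have h1 : A * x + (2 * A - Γ) * z = w * r - (x * δ A + y * δ B + z * δ Γ) := by rw [← hδw, hδw']; ring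
    rw [h1, pow_two]
    exact Ideal.sub_mem _ (Ideal.mul_mem_mul hwm hr)
      (Ideal.add_mem _ (Ideal.add_mem _ (Ideal.mul_mem_mul hxm (hδm A)) (Ideal.mul_mem_mul hym (hδm B)))
        (Ideal.mul_mem_mul hzm (hδm Γ)))
  -- linear independence of `(x, y, z)` modulo `𝔪²`
  have hrel : ∑ i, (![A, 0, 2 * A - Γ] : Fin 3 → R) i * (![x, y, z] : Fin 3 → R) i ∈ maximalIdeal R ^ 2 := by
    simpa [Fin.sum_univ_three] using hsq
  have hA : A ∈ maximalIdeal R := by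
    simpa using hz.forall_mem_maximalIdeal_of_sum_mul_mem_sq _ hrel 0
  have hAΓ : 2 * A - Γ ∈ maximalIdeal R := by
    simpa using hz.forall_mem_maximalIdeal_of_sum_mul_mem_sq _ hrel 2
  have hΓm : Γ ∈ maximalIdeal R := by
    have h1 : Γ = 2 * A - (2 * A - Γ) := by ring
    rw [h1]
    exact Ideal.sub_mem _ (Ideal.mul_mem_left _ _ hA) hAΓ
  exact (IsLocalRing.mem_maximalIdeal Γ).mp hΓm hΓ

/-- **The strict transform is STILL not clean-permissible.**  `R` regular local of dimension `3` with regular system of parameters `(x, y, z)`,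
embedded by `f` in a field `F` of ODD characteristic `p`, residue field `p`-perfect; `∂_y` a derivation of `R` with `∂_y x = ∂_y z = 0`, `∂_y y = 1`,
and `δ` a derivation of `R` VANISHING AT THE POINT (`δ (R) ⊆ 𝔪`) with `δ x = x + 2z`, `δ y = 0`, `δ z = -z` (in coordinates
`δ = (x + 2z) ∂_x - z ∂_z`), both extending along `f` to derivations of `F` — all true in `k[x, y, z]_{(x,y,z)}`, `k` perfect.  Then `Y' = V(x, y)` is
NOT clean-permissible for the line of `G = z (x + z)`.  Proof: both derivations kill `G`; by the first-order obstruction every adapted generator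
`c_k` of `(x, y)` has exponent `a_k ≡ 0 (mod p)` (`strictTransform_gen`), so the transversal member `w` carries the exponent prime to `p`, and the
second-order obstruction for `δ` gives `δ w ∈ w 𝔪`, excluded by `strictTransform_trans`.
[cite: Piltant2013, §2 Axiom 4] [cite: CossartPiltant2008, Lemma 4.3 (5)] -/
theorem not_cleanPermissibleAt_strictTransform_blowupWitness {R : Type u} {F : Type u} [CommRing R] [IsLocalRing R] [Field F] {p : ℕ}
    [Fact p.Prime] [CharP F p] (hp2 : p ≠ 2) {f : R →+* F} (hf : Function.Injective f) (hR : IsRegularLocalRing R)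
    (hdim : ringKrullDim R = 3) {x y z : R} (h : Ideal.span ({x, y, z} : Set R) = maximalIdeal R)
    (hperf : ∀ u : R, ∃ c : R, u - c ^ p ∈ maximalIdeal R)
    (dy δ : Derivation ℤ R R) (Dy Δ : Derivation ℤ F F) (hDy : ∀ r, Dy (f r) = f (dy r)) (hΔ : ∀ r, Δ (f r) = f (δ r))
    (hyx : dy x = 0) (hyy : dy y = 1) (hyz : dy z = 0)
    (hδm : ∀ r : R, δ r ∈ maximalIdeal R) (hδx : δ x = x + 2 * z) (hδy : δ y = 0) (hδz : δ z = -z) :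
    ¬ CleanPermissibleAt p f (f (z * (x + z))) (Ideal.span ({x, y} : Set R)) := by
  classical
  haveI : CharP R p := f.charP hf p
  intro hcp
  obtain ⟨n, l, c, w, a, b, u, hz, hcI, hu, hex, hkill⟩ := hcp.exists_adapted_apply_eq_zero hf hperf
  -- both derivations kill `G = z (x + z)`
  have hdyG : dy (z * (x + z)) = 0 := by
    rw [Derivation.leibniz, map_add, hyx, hyz]; simp
  have hδG : δ (z * (x + z)) = 0 := by
    rw [Derivation.leibniz, map_add, hδx, hδz]; simp only [smul_eq_mul]; ring
  have hDyG : Dy (f (z * (x + z))) = 0 := by rw [hDy, hdyG, map_zero]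
  have hΔG : Δ (f (z * (x + z))) = 0 := by rw [hΔ, hδG, map_zero]
  have hkdy := hkill Dy dy hDy hDyG
  have hkδ := hkill Δ δ hΔ hΔG
  -- first order: every `c k` has exponent divisible by `p`
  have ha : ∀ k, p ∣ a k := by
    intro k
    by_contra hk
    have hck : c k ∈ Ideal.span ({x, y} : Set R) := hcI ▸ Ideal.subset_span ⟨k, rfl⟩
    have hck2 : c k ∉ maximalIdeal R ^ 2 := by
      have h2 := hz.not_mem_sq (Fin.castAdd l k); rwa [Fin.append_left] at h2
    have hd1 : c k ∣ dy (c k) := by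
      have h1 := hz.dvd_derivation_apply_of_apply_eq_zero p dy hu (Fin.append a b) hkdy (i := Fin.castAdd l k)
        (by rwa [Fin.append_left])
      rwa [Fin.append_left] at h1
    have hd2 : c k ∣ δ (c k) := by
      have h1 := hz.dvd_derivation_apply_of_apply_eq_zero p δ hu (Fin.append a b) hkδ (i := Fin.castAdd l k)
        (by rwa [Fin.append_left])
      rwa [Fin.append_left] at h1
    exact strictTransform_gen hR hdim hp2 h dy δ hyx hyy hδx hδy hck hck2 hd1 hd2
  -- so some `w m` carries an exponent prime to `p`
  obtain ⟨m, hm⟩ : ∃ m, ¬ p ∣ b m := by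
    rcases hex with ⟨k, hk⟩ | hmex
    · exact absurd (ha k) hk
    · exact hmex
  -- second order for `δ`
  obtain ⟨r, hr, hsum⟩ := hz.sum_logDerivative_mem_maximalIdeal p δ hδm hu (Fin.append a b) hkδ
  -- dimension count: `n + l ≤ 3` (the adapted system is part of a regular system of parameters of the 3-dimensional `R`)
  have hxyz := isRsopPart_vec3_of_span_eq hR hdim h
  have hnl : n + l ≤ 3 := by
    obtain ⟨-, e, -, hd, -⟩ := hz
    rw [hdim] at hd
    have h3 : ((n + l + e : ℕ) : WithBot ℕ∞) = (3 : ℕ) := by rw [← hd]; norm_cast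
    have h3' : n + l + e = 3 := by exact_mod_cast h3
    omega
  -- `n ≥ 2`: `(c) = (x, y)` is neither `⊥` nor principal
  have hIm : Ideal.span ({x, y} : Set R) ≤ maximalIdeal R := by
    rw [← h]; exact Ideal.span_mono (by intro a ha; rcases ha with rfl | rfl <;> simp)
  have hn2 : 2 ≤ n := by
    by_contra hn
    have hxI : x ∈ Ideal.span (Set.range c) := hcI ▸ Ideal.subset_span (by simp)
    have hyI : y ∈ Ideal.span (Set.range c) := hcI ▸ Ideal.subset_span (by simp)
    interval_cases n
    · -- `n = 0`
      have h0 : Set.range c = ∅ := Set.range_eq_empty _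
      rw [h0, Ideal.span_empty, Ideal.mem_bot] at hxI
      exact hxyz.ne_zero 0 (by simpa using hxI)
    · -- `n = 1`
      have h1 : Set.range c = {c 0} := by
        ext a
        simp only [Set.mem_range, Set.mem_singleton_iff]
        constructor
        · rintro ⟨i, rfl⟩; rw [Subsingleton.elim i 0]
        · rintro rfl; exact ⟨0, rfl⟩
      rw [h1] at hxI hyI
      obtain ⟨s, hs⟩ := Ideal.mem_span_singleton'.mp hxI
      obtain ⟨t, ht⟩ := Ideal.mem_span_singleton'.mp hyI
      have hrel : ∑ i, (![t, -s, 0] : Fin 3 → R) i * (![x, y, z] : Fin 3 → R) i ∈ maximalIdeal R ^ 2 := by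
        have h0 : ∑ i, (![t, -s, 0] : Fin 3 → R) i * (![x, y, z] : Fin 3 → R) i = 0 := by
          simp only [Fin.sum_univ_three]; simp; rw [← hs, ← ht]; ring
        rw [h0]; exact zero_mem _
      have hsm : s ∈ maximalIdeal R := by
        simpa using hxyz.forall_mem_maximalIdeal_of_sum_mul_mem_sq _ hrel 1
      have hc0m : c 0 ∈ maximalIdeal R := hIm (hcI ▸ (h1 ▸ Ideal.subset_span rfl : c 0 ∈ Ideal.span (Set.range c)))
      apply hxyz.not_mem_sq 0
      show (![x, y, z] : Fin 3 → R) 0 ∈ maximalIdeal R ^ 2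
      simp only [Matrix.cons_val_zero]
      rw [← hs, pow_two]
      exact Ideal.mul_mem_mul hsm hc0m
  have hl1 : 1 ≤ l := by
    rcases Nat.eq_zero_or_pos l with hl | hl
    · subst hl; exact absurd m.2 (by simp)
    · exact hl
  obtain ⟨hn, hl⟩ : n = 2 ∧ l = 1 := ⟨by omega, by omega⟩
  subst hn; subst hl
  -- the `w`-block of the logarithmic derivative is the single term `b 0 · r`
  have hm0 : m = 0 := Subsingleton.elim m 0
  subst hm0
  have hsum' : ((b 0 : ℕ) : R) * r (Fin.natAdd 2 0) ∈ maximalIdeal R := by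
    rw [Fin.sum_univ_add] at hsum
    simp only [Fin.append_left, Fin.append_right, Fin.sum_univ_one] at hsum
    have hc0 : ∑ k : Fin 2, ((a k : ℕ) : R) * r (Fin.castAdd 1 k) = 0 :=
      Finset.sum_eq_zero fun k _ => by rw [(CharP.cast_eq_zero_iff R p _).mpr (ha k), zero_mul]
    rwa [hc0, zero_add] at hsum
  have hb : IsUnit (((b 0 : ℕ) : R)) := isUnit_natCast_of_not_dvd p hm
  have hrm : r (Fin.natAdd 2 0) ∈ maximalIdeal R := (Ideal.unit_mul_mem_iff_mem _ hb).mp hsum'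
  -- the transversal member `w 0`
  have hw0m : w 0 ∈ maximalIdeal R := by
    have h1 := hz.mem_maximalIdeal (Fin.natAdd 2 0); rwa [Fin.append_right] at h1
  have hw02 : w 0 ∉ Ideal.span ({x, y} : Set R) ⊔ maximalIdeal R ^ 2 := by
    rw [← hcI]; exact append_right_not_mem_span_sup_sq hz 0
  have hδw : δ (w 0) = w 0 * r (Fin.natAdd 2 0) := by
    have h1 := hr (Fin.natAdd 2 0) (by rwa [Fin.append_right]); rwa [Fin.append_right] at h1
  exact strictTransform_trans hR hdim h δ hδm hδx hδy hδz hw0m hw02 hrm hδw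

end BlowupWitness

end Summit.ResolutionOfSingularities.ResolutionOfSingularities.Theorems.RadicialJung.CleanModels

end
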